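import Mathlib
import Summits.Ventures.PercRepro2.Defs
import Summits.Ventures.PercRepro2.Graph
import Summits.Ventures.PercRepro2.OneColourSwitch
import Summits.Ventures.PercRepro2.RegionHubSign
import Summits.Ventures.PercRepro2.SideSwitch
import Summits.Ventures.PercRepro2.TermSwitchDefs
import Summits.Ventures.PercRepro2.TermSwitchFibre
import Summits.Ventures.PercRepro2.TermSwitchCompsFibre
import Summits.Ventures.PercRepro2.TermSwitchM9
import Summits.Ventures.PercRepro2.M9LoopTransfer
import Summits.Ventures.PercRepro2.M9PendantSeries
import Summits.Ventures.PercRepro2.M9NoPocketDefs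
import Summits.Ventures.PercRepro2.M9YSliceDefs

/-!
# Transfer lemmas for a non-mark of degree three (blind cell PercRepro2, p3 g26, 2026-08-28;
`proofs/P3-YSLICE.md` §2)

Let the non-mark `d` carry exactly three non-loop edges `e₁, e₂, e₃` with `ends eᵢ = {d, xᵢ}`.
On a colouring with the pattern `(c, c, c̄)` on `(e₁, e₂, e₃)` the vertex `d` acts, in colour
`c`, as the edge `{x₁, x₂}` and, in colour `c̄`, as a pendant: for `a, b ≠ d` the connections of
`G` are those of `G_12` (`endsPair`: `e₁` re-attached as `{x₁, x₂}`, `e₂, e₃` looped)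
(`conn_three_iff`, from the lane's `conn_series_same_iff` / `conn_pendantLoop_iff` after looping
the edge of the other colour, which that colour's open graph does not see:
`conn_update_of_closed`).  Hence the kernel of the single-`d` sum (`dker`) equals the `DZero`
kernel of `G_12` (`zker`) on such colourings (`dker_eq_zker_three`); the kernels are
flip-invariant (`dker_compl`) and blind to loops (`zker_update_loop`).  Own work; std axioms.
-/

namespace Summit.Ventures.PercRepro2

namespace NoPocket

open Finset Classical OneColourSwitch SideSwitch TermSwitch M9Reduce

variable {V : Type*} {E : Type*}
variable [Fintype V] [DecidableEq V] [Fintype E] [DecidableEq E]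

section Transfer

variable {ends : E → Sym2 V}

omit [Fintype V] [DecidableEq V] [Fintype E] in
/-- A closed edge can be re-attached anywhere without changing any connection. -/
lemma conn_update_of_closed {ω : Config E} {e₀ : E} (h : ω e₀ = false) (t : Sym2 V) {a b : V} :
    Conn (Function.update ends e₀ t) ω a b ↔ Conn ends ω a b := by
  have hG : openGraph (Function.update ends e₀ t) ω = openGraph ends ω := by
    ext u v
    rw [openGraph_adj, openGraph_adj]
    constructor
    · rintro ⟨huv, e, he, hends⟩
      have hee : e ≠ e₀ := by
        rintro rfl
        rw [h] at he
        exact Bool.false_ne_true he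
      refine ⟨huv, e, he, ?_⟩
      rwa [Function.update_of_ne hee] at hends
    · rintro ⟨huv, e, he, hends⟩
      have hee : e ≠ e₀ := by
        rintro rfl
        rw [h] at he
        exact Bool.false_ne_true he
      refine ⟨huv, e, he, ?_⟩
      rw [Function.update_of_ne hee]
      exact hends
  simp only [Conn, hG]

/-- The graph `G_ij`: `e₁` re-attached as `{x₁, x₂}`, `e₂` and `e₃` looped at `d`. -/
def endsPair (ends : E → Sym2 V) (e₁ e₂ e₃ : E) (d x₁ x₂ : V) : E → Sym2 V :=
  Function.update (Function.update (Function.update ends e₁ s(x₁, x₂)) e₂ s(d, d)) e₃ s(d, d)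

omit [Fintype V] [DecidableEq V] [Fintype E] in
/-- **Transfer for the pattern `(c, c, c̄)`**: if the non-loop edges at `d` are exactly
`e₁, e₂, e₃`, and `ω` colours `e₁, e₂` alike and `e₃` differently, then for `a, b ≠ d` the
connection `a ↔ b` is the same in `G` and in `G_12`. -/
lemma conn_three_iff {ω : Config E} {e₁ e₂ e₃ : E} {d x₁ x₂ x₃ : V}
    (h12 : e₁ ≠ e₂) (h13 : e₁ ≠ e₃) (h23 : e₂ ≠ e₃)
    (hd : ∀ e, d ∈ ends e → ¬ (ends e).IsDiag → e = e₁ ∨ e = e₂ ∨ e = e₃)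
    (h₁ : ends e₁ = s(d, x₁)) (h₂ : ends e₂ = s(d, x₂)) (h₃ : ends e₃ = s(d, x₃))
    (hx₁ : x₁ ≠ d) (hx₂ : x₂ ≠ d)
    (hc : ω e₁ = ω e₂) (hc3 : ω e₃ = !ω e₁) {a b : V} (ha : a ≠ d) (hb : b ≠ d) :
    Conn ends ω a b ↔ Conn (endsPair ends e₁ e₂ e₃ d x₁ x₂) ω a b := by
  unfold endsPair
  cases hω : ω e₁ with
  | true =>
    -- `e₃` is closed: loop it, then `d` has the two `Y`-edges `e₁, e₂`
    have he₃ : ω e₃ = false := by rw [hc3, hω]; rfl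
    rw [← conn_update_of_closed (ends := ends) he₃ s(d, d)]
    have hd' : ∀ e, d ∈ Function.update ends e₃ s(d, d) e →
        ¬ (Function.update ends e₃ s(d, d) e).IsDiag → e = e₁ ∨ e = e₂ := by
      intro e hde hnd
      by_cases hee : e = e₃
      · subst hee
        simp at hnd
      · rw [Function.update_of_ne hee] at hde hnd
        rcases hd e hde hnd with h | h | h
        · exact Or.inl h
        · exact Or.inr h
        · exact (hee h).elim
    have e1 : Function.update ends e₃ s(d, d) e₁ = s(d, x₁) := by
      rw [Function.update_of_ne h13, h₁]
    have e2 : Function.update ends e₃ s(d, d) e₂ = s(d, x₂) := by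
      rw [Function.update_of_ne h23, h₂]
    rw [conn_series_same_iff h12 hd' e1 e2 hx₁ hx₂ hc ha hb]
    rw [Function.update_comm h13.symm, Function.update_comm h23.symm]
  | false =>
    -- `e₁, e₂` are closed and `e₃` is open: `d` is a pendant in this colour
    have he₂ : ω e₂ = false := by rw [← hc, hω]
    have he₃ : ω e₃ = true := by rw [hc3, hω]; rfl
    have hl : Conn ends ω a b ↔
        Conn (Function.update (Function.update ends e₁ s(d, d)) e₂ s(d, d)) ω a b := by
      rw [conn_update_of_closed (ends := Function.update ends e₁ s(d, d)) he₂,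
        conn_update_of_closed (ends := ends) hω]
    have hd' : ∀ e, d ∈ Function.update (Function.update ends e₁ s(d, d)) e₂ s(d, d) e →
        ¬ (Function.update (Function.update ends e₁ s(d, d)) e₂ s(d, d) e).IsDiag → e = e₃ := by
      intro e hde hnd
      by_cases hee2 : e = e₂
      · subst hee2; simp at hnd
      · by_cases hee1 : e = e₁
        · subst hee1; simp [Function.update_of_ne h12] at hnd
        · rw [Function.update_of_ne hee2, Function.update_of_ne hee1] at hde hnd
          rcases hd e hde hnd with h | h | h
          · exact (hee1 h).elim
          · exact (hee2 h).elim
          · exact h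
    have e3 : Function.update (Function.update ends e₁ s(d, d)) e₂ s(d, d) e₃ = s(d, x₃) := by
      rw [Function.update_of_ne h23.symm, Function.update_of_ne h13.symm, h₃]
    rw [hl, conn_pendantLoop_iff hd' e3 ha hb]
    -- the right-hand side: `e₁` is closed, so re-attaching it as a loop changes nothing
    rw [← conn_update_of_closed
      (ends := Function.update (Function.update (Function.update ends e₁ s(x₁, x₂)) e₂ s(d, d))
        e₃ s(d, d)) hω s(d, d)]
    rw [Function.update_comm h13.symm, Function.update_comm h12.symm, Function.update_idem]

end Transfer

section Kernels

variable (ends : E → Sym2 V)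

/-- The kernel of the single-`d` sum: `1_{Sep ∧ DOne(d)} · σ_pq · σ_rs`. -/
noncomputable def dker (p q r s d : V) (ω : Config E) : ℤ :=
  if sep2 ends p q r s ω ∧ DOne ends r s d ω then sigma ends ω p q * sigma ends ω r s else 0

/-- The kernel of the `DZero` sum of the terminal set `{r, s}`. -/
noncomputable def zker (p q r s : V) (ω : Config E) : ℤ :=
  if sepH ends p q ({r, s} : Set V) ω ∧ DZeroH ends ({r, s} : Set V) ω then
    sigma ends ω p q * sigma ends ω r s else 0

variable {ends}

omit [Fintype V] [DecidableEq V] in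
/-- `dSignSum` is the sum of its kernel. -/
lemma dSignSum_eq_sum_dker (p q r s d : V) :
    dSignSum ends p q r s d = ∑ ω : Config E, dker ends p q r s d ω := rfl

omit [Fintype V] [DecidableEq V] in
/-- `dzeroSignSumH` is the sum of its kernel. -/
lemma dzeroSignSumH_eq_sum_zker (p q r s : V) :
    dzeroSignSumH ends p q r s ({r, s} : Set V) = ∑ ω : Config E, zker ends p q r s ω := rfl

omit [Fintype V] [DecidableEq V] [Fintype E] [DecidableEq E] in
/-- The kernel of the single-`d` sum is invariant under the colour flip. -/
lemma dker_compl (p q r s d : V) (ω : Config E) :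
    dker ends p q r s d (OneColourSwitch.compl ω) = dker ends p q r s d ω := by
  unfold dker
  have h : (sep2 ends p q r s (OneColourSwitch.compl ω) ∧
      DOne ends r s d (OneColourSwitch.compl ω)) ↔ (sep2 ends p q r s ω ∧ DOne ends r s d ω) := by
    rw [sep2_compl]
    refine and_congr_right (fun _ => ⟨fun h => ?_, DOne_compl⟩)
    have := DOne_compl h
    rwa [OneColourSwitch.compl_compl] at this
  rw [if_congr h rfl rfl, sigma_compl, sigma_compl]
  ring_nf

omit [Fintype V] [DecidableEq V] [Fintype E] in
/-- The `DZero` kernel ignores the colour of a loop. -/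
lemma zker_update_loop {e₀ : E} (hd : (ends e₀).IsDiag) (p q r s : V) (ω : Config E)
    (b : Bool) : zker ends p q r s (Function.update ω e₀ b) = zker ends p q r s ω := by
  have hK : KH ends ({r, s} : Set V) (Function.update ω e₀ b) = KH ends ({r, s} : Set V) ω := by
    ext x
    simp only [mem_KH_iff, conn_update_loop_iff hd]
  have hM : MH ends ({r, s} : Set V) (Function.update ω e₀ b) = MH ends ({r, s} : Set V) ω := by
    ext x
    simp only [mem_MH_iff, compl_update, conn_update_loop_iff hd]
  unfold zker
  simp only [sepH, DZeroH, sigma, hK, hM, conn_update_loop_iff hd, compl_update]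

omit [Fintype V] [DecidableEq V] [Fintype E] in
/-- **Kernel transfer for the pattern `(c, c, c̄)`**: `dker (G) = zker (G_12)` on such colourings. -/
lemma dker_eq_zker_three {p q r s : V} {e₁ e₂ e₃ : E} {d x₁ x₂ x₃ : V}
    (h12 : e₁ ≠ e₂) (h13 : e₁ ≠ e₃) (h23 : e₂ ≠ e₃)
    (hd : ∀ e, d ∈ ends e → ¬ (ends e).IsDiag → e = e₁ ∨ e = e₂ ∨ e = e₃)
    (h₁ : ends e₁ = s(d, x₁)) (h₂ : ends e₂ = s(d, x₂)) (h₃ : ends e₃ = s(d, x₃))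
    (hx₁ : x₁ ≠ d) (hx₂ : x₂ ≠ d)
    (hp : p ≠ d) (hq : q ≠ d) (hr : r ≠ d) (hs : s ≠ d)
    {ω : Config E} (hc : ω e₁ = ω e₂) (hc3 : ω e₃ = !ω e₁) :
    dker ends p q r s d ω = zker (endsPair ends e₁ e₂ e₃ d x₁ x₂) p q r s ω := by
  have hY : ∀ a b, a ≠ d → b ≠ d →
      (Conn ends ω a b ↔ Conn (endsPair ends e₁ e₂ e₃ d x₁ x₂) ω a b) :=
    fun a b ha hb => conn_three_iff h12 h13 h23 hd h₁ h₂ h₃ hx₁ hx₂ hc hc3 ha hb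
  have hW : ∀ a b, a ≠ d → b ≠ d →
      (Conn ends (OneColourSwitch.compl ω) a b ↔
        Conn (endsPair ends e₁ e₂ e₃ d x₁ x₂) (OneColourSwitch.compl ω) a b) := by
    intro a b ha hb
    refine conn_three_iff h12 h13 h23 hd h₁ h₂ h₃ hx₁ hx₂ ?_ ?_ ha hb
    · simp only [OneColourSwitch.compl, hc]
    · simp only [OneColourSwitch.compl, hc3]
  -- `d` is isolated in `G_12`
  have hiso : ∀ e, d ∈ endsPair ends e₁ e₂ e₃ d x₁ x₂ e → ω e = true →
      (endsPair ends e₁ e₂ e₃ d x₁ x₂ e).IsDiag := by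
    intro e hde _
    by_cases hee3 : e = e₃
    · subst hee3; simp [endsPair]
    by_cases hee2 : e = e₂
    · subst hee2; simp [endsPair, Function.update_of_ne h23]
    by_cases hee1 : e = e₁
    · subst hee1
      simp only [endsPair, Function.update_of_ne h13, Function.update_of_ne h12,
        Function.update_self] at hde ⊢
      rw [Sym2.mem_iff] at hde
      rcases hde with rfl | rfl
      · exact (hx₁ rfl).elim
      · exact (hx₂ rfl).elim
    · simp only [endsPair, Function.update_of_ne hee3, Function.update_of_ne hee2,
        Function.update_of_ne hee1] at hde ⊢
      by_contra hnd
      rcases hd e hde hnd with h | h | h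
      · exact hee1 h
      · exact hee2 h
      · exact hee3 h
  have hisoW : ∀ e, d ∈ endsPair ends e₁ e₂ e₃ d x₁ x₂ e → OneColourSwitch.compl ω e = true →
      (endsPair ends e₁ e₂ e₃ d x₁ x₂ e).IsDiag := by
    intro e hde _
    by_cases hee3 : e = e₃
    · subst hee3; simp [endsPair]
    by_cases hee2 : e = e₂
    · subst hee2; simp [endsPair, Function.update_of_ne h23]
    by_cases hee1 : e = e₁
    · subst hee1
      simp only [endsPair, Function.update_of_ne h13, Function.update_of_ne h12,
        Function.update_self] at hde ⊢
      rw [Sym2.mem_iff] at hde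
      rcases hde with rfl | rfl
      · exact (hx₁ rfl).elim
      · exact (hx₂ rfl).elim
    · simp only [endsPair, Function.update_of_ne hee3, Function.update_of_ne hee2,
        Function.update_of_ne hee1] at hde ⊢
      by_contra hnd
      rcases hd e hde hnd with h | h | h
      · exact hee1 h
      · exact hee2 h
      · exact hee3 h
  have hdK : d ∉ KH (endsPair ends e₁ e₂ e₃ d x₁ x₂) ({r, s} : Set V) ω := by
    rintro ⟨h, hh, hc'⟩
    simp only [Set.mem_insert_iff, Set.mem_singleton_iff] at hh
    have := eq_of_conn_of_loops hiso hc'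
    rcases hh with rfl | rfl
    · exact hr this
    · exact hs this
  -- the worlds of the other vertices agree
  have hKiff : ∀ x, x ≠ d → (x ∈ K2 ends r s ω ↔
      x ∈ KH (endsPair ends e₁ e₂ e₃ d x₁ x₂) ({r, s} : Set V) ω) := by
    intro x hx
    rw [mem_K2_iff, mem_KH_iff]
    constructor
    · rintro (h | h)
      · exact ⟨r, by simp, (hY r x hr hx).1 h⟩
      · exact ⟨s, by simp, (hY s x hs hx).1 h⟩
    · rintro ⟨h, hh, hc'⟩
      simp only [Set.mem_insert_iff, Set.mem_singleton_iff] at hh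
      rcases hh with rfl | rfl
      · exact Or.inl ((hY h x hr hx).2 hc')
      · exact Or.inr ((hY h x hs hx).2 hc')
  have hMiff : ∀ x, x ≠ d → (x ∈ M2 ends r s ω ↔
      x ∈ MH (endsPair ends e₁ e₂ e₃ d x₁ x₂) ({r, s} : Set V) ω) := by
    intro x hx
    rw [mem_M2_iff, mem_MH_iff]
    constructor
    · rintro (h | h)
      · exact ⟨r, by simp, (hW r x hr hx).1 h⟩
      · exact ⟨s, by simp, (hW s x hs hx).1 h⟩
    · rintro ⟨h, hh, hc'⟩
      simp only [Set.mem_insert_iff, Set.mem_singleton_iff] at hh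
      rcases hh with rfl | rfl
      · exact Or.inl ((hW h x hr hx).2 hc')
      · exact Or.inr ((hW h x hs hx).2 hc')
  have hsep : sep2 ends p q r s ω ↔ sep2 (endsPair ends e₁ e₂ e₃ d x₁ x₂) p q r s ω := by
    simp only [sep2, sepY, hY p r hp hr, hY p s hp hs, hY q r hq hr, hY q s hq hs,
      hW p r hp hr, hW p s hp hs, hW q r hq hr, hW q s hq hs]
  have hcond : (sep2 ends p q r s ω ∧ DOne ends r s d ω) ↔
      (sepH (endsPair ends e₁ e₂ e₃ d x₁ x₂) p q ({r, s} : Set V) ω ∧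
        DZeroH (endsPair ends e₁ e₂ e₃ d x₁ x₂) ({r, s} : Set V) ω) := by
    constructor
    · rintro ⟨h1, h2⟩
      refine ⟨sepH_pair_of_sep2 (hsep.1 h1), ?_⟩
      intro x hxH hxK hxM
      have hxr : x ≠ r := fun h => hxH (by rw [h]; simp)
      have hxs : x ≠ s := fun h => hxH (by rw [h]; simp)
      by_cases hxd : x = d
      · subst hxd; exact hdK hxK
      · exact h2 x hxr hxs hxd ((hKiff x hxd).2 hxK) ((hMiff x hxd).2 hxM)
    · rintro ⟨h1, h2⟩
      refine ⟨hsep.2 (sep2_of_sepH (by simp) (by simp) h1), ?_⟩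
      intro x hxr hxs hxd hxK hxM
      have hxH : x ∉ ({r, s} : Set V) := by
        simp only [Set.mem_insert_iff, Set.mem_singleton_iff, not_or]
        exact ⟨hxr, hxs⟩
      exact h2 x hxH ((hKiff x hxd).1 hxK) ((hMiff x hxd).1 hxM)
  unfold dker zker
  rw [if_congr hcond rfl rfl]
  unfold sigma
  rw [if_congr (hY p q hp hq) rfl rfl, if_congr (hW p q hp hq) rfl rfl,
    if_congr (hY r s hr hs) rfl rfl, if_congr (hW r s hr hs) rfl rfl]

end Kernels


end NoPocket

end Summit.Ventures.PercRepro2
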